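import Mathlib
import HarnessLib
import Summits.ResolutionOfSingularities.ResolutionOfSingularities.Theorems.WildQuotientsWildQuotientResolutionJordanThreeChartAlgebra
import Summits.ResolutionOfSingularities.ResolutionOfSingularities.Theorems.WildQuotientsWildQuotientResolutionJordanThreeK3ChartAlgebra

/-!
# The `J₃` monomial ideal `K₃`: the two characteristic-3 charts (rung V3, design of record §4)
(crux stmt-ResolutionOfSingularities-15640 `WildQuotients.WildQuotientResolution`, line `Sketch`;
chain w45c rung V3, `L/res-L1-w45c-lead-1/V3-K3-DESIGN.md` §3–§4; [OURS · L1 W4.5c] — NOT a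
statement of any manuscript.)

Continuation of `…JordanThreeK3ChartAlgebra` (charts 0, 2, 4 of `Bl_{K₃} 𝔸ⁿ`): the charts
`j = 1` (`m_j = x_a³x_b`, coordinates `u = x_a/x_b`, `y = x_b³/x_a²`) and `j = 3`
(`m_j = x_a x_b⁴`, coordinates `w = x_b²/x_a`, `z = x_a²/x_b³`), where the augmentation ideal is
`(u²)` resp. `(w²z)` BECAUSE `(1 + x)³ = 1 + x³` in characteristic `3` (for `p ≥ 5` these charts
give `u·(u,y)` / `wz·(w,z)`, the cycling corner of the plain game). Same abstract setting: `S`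
local, `T = m_j` a non-zero-divisor, `T · U l = m_l(Xa, Xb)`, `a Xa = Xa`, `a Xb = Xb + m Xa`.
-/

-- single-problem summit: the doubled namespace component `ResolutionOfSingularities` is forced
set_option linter.dupNamespace false

noncomputable section

namespace Summit.ResolutionOfSingularities.ResolutionOfSingularities.Theorems.WildQuotientResolution.JordanThree.K3

universe u

variable {S : Type u} [CommRing S]

section Charts

variable (Xa Xb T m : S) (U : Fin 5 → S) (a : S →+* S)

/-- **Chart 1 (`m_j = x_a³x_b`, chart B2a): the ideal is `(u²)`, `u = U₀` — TERMINAL in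
characteristic 3.** `x_a = u³y`, `x_b = u²y` (`y = U₃`), `U₂ = uy`, `U₄ = uy²`;
`a u · (1 + m u) = u` (so `1 + m u` is a unit in the local ring `S`), `a y = y (1 + m u)³ =
y (1 + m³u³)`. [folklore] -/
theorem chart1_isPrincipal [IsLocalRing S] (h3 : (3 : S) = 0) (hm : IsUnit m)
    (haXa : a Xa = Xa) (haXb : a Xb = Xb + m * Xa)
    (hT : T ∈ nonZeroDivisors S) (hT1 : T = Xa ^ 3 * Xb)
    (hU0 : T * U 0 = Xa ^ 4) (hU1 : T * U 1 = Xa ^ 3 * Xb) (hU2 : T * U 2 = Xa ^ 2 * Xb ^ 3)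
    (hU3 : T * U 3 = Xa * Xb ^ 4) (hU4 : T * U 4 = Xb ^ 6) :
    (Ideal.span {Xa, Xb} ⊔
      Ideal.span (Set.range fun l : {l : Fin 5 // l ≠ 1} => a (U l) - U l)).IsPrincipal := by
  subst hT1
  obtain ⟨m', hmm'⟩ := hm.exists_right_inv
  have hXa : Xa ∈ nonZeroDivisors S := nzd_of_pow_succ (n := 2) (nzd_of_mul_left hT)
  have hXb : Xb ∈ nonZeroDivisors S := nzd_of_mul_right hT
  -- `u = U 0`, `y = U 3`: `Xb u = Xa`, `Xa² y = Xb³`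
  have e1 : Xb * U 0 = Xa := by
    refine cancel_nzd (pow_mem hXa 3) ?_
    linear_combination hU0
  have e2 : Xa ^ 2 * U 3 = Xb ^ 3 := by
    refine cancel_nzd (mul_mem hXa hXb) ?_
    linear_combination hU3
  -- `Xb = u² y`, `Xa = u³ y`
  have eXb : Xb = U 0 ^ 2 * U 3 := by
    refine cancel_nzd (pow_mem hXb 2) ?_
    linear_combination -e2 - (Xb * U 0 + Xa) * U 3 * e1
  have eXa : Xa = U 0 ^ 3 * U 3 := by rw [← e1, eXb]; ring
  -- the other generators
  have e3 : U 2 = U 0 * U 3 := by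
    refine cancel_nzd hT ?_
    rw [hU2, eXa, eXb]; ring
  have e4 : U 4 = U 0 * U 3 ^ 2 := by
    refine cancel_nzd hT ?_
    rw [hU4, eXa, eXb]; ring
  have e5 : a (U 1) - U 1 = 0 := sub_self_of_mul_eq hT (by rw [hU1]) a
  -- the action: `a Xb = Xb (1 + m u)`, `a u (1 + m u) = u`, `a y = y (1 + m u)³`
  have haXb' : a Xb = Xb * (1 + m * U 0) := by rw [haXb, ← e1]; ring
  have haT : a (Xa ^ 3 * Xb) = Xa ^ 3 * Xb * (1 + m * U 0) := by
    rw [map_mul, map_pow, haXa, haXb']; ring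
  have hau : a (U 0) * (1 + m * U 0) = U 0 := by
    refine cancel_nzd hT ?_
    have h := congrArg a hU0
    rw [map_mul, haT, map_pow, haXa, ← hU0] at h
    linear_combination h
  have heu : IsUnit (1 + m * U 0) := isUnit_one_add_mul_of_mul_eq (U 0) (a (U 0)) m hau
  obtain ⟨e', hee'⟩ := heu.exists_right_inv
  have hau' : a (U 0) = e' * U 0 := by
    calc a (U 0) = a (U 0) * ((1 + m * U 0) * e') := by rw [hee', mul_one]
      _ = e' * (a (U 0) * (1 + m * U 0)) := by ring
      _ = e' * U 0 := by rw [hau]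
  have hay : a (U 3) = U 3 * (1 + m * U 0) ^ 3 := by
    have h := congrArg a hU3
    rw [map_mul, haT, map_mul, map_pow, haXa, haXb'] at h
    have h' : (Xa ^ 3 * Xb) * ((1 + m * U 0) * a (U 3)) =
        (Xa ^ 3 * Xb) * ((1 + m * U 0) * (U 3 * (1 + m * U 0) ^ 3)) := by
      linear_combination h - (1 + m * U 0) ^ 4 * hU3
    have h'' := cancel_nzd hT h'
    calc a (U 3) = (e' * (1 + m * U 0)) * a (U 3) := by rw [mul_comm e', hee', one_mul]
      _ = e' * ((1 + m * U 0) * a (U 3)) := by ring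
      _ = e' * ((1 + m * U 0) * (U 3 * (1 + m * U 0) ^ 3)) := by rw [h'']
      _ = ((1 + m * U 0) * e') * (U 3 * (1 + m * U 0) ^ 3) := by ring
      _ = U 3 * (1 + m * U 0) ^ 3 := by rw [hee', one_mul]
  -- the ideal is `(u²)`
  set I := Ideal.span {Xa, Xb} ⊔
    Ideal.span (Set.range fun l : {l : Fin 5 // l ≠ 1} => a (U l) - U l) with hI
  let K : Ideal S := Ideal.span {U 0 ^ 2}
  have hmem : ∀ x : S, (∃ q, q * U 0 ^ 2 = x) → x ∈ K := fun x hx =>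
    Ideal.mem_span_singleton'.mpr hx
  have hKu : a (U 0) - U 0 ∈ K :=
    hmem _ ⟨-(e' * m), by rw [hau']; linear_combination (-(U 0)) * hee'⟩
  have hKy : a (U 3) - U 3 ∈ K :=
    hmem _ ⟨U 3 * m ^ 3 * U 0, by
      rw [hay]; linear_combination (-(U 3 * (m * U 0 + m ^ 2 * U 0 ^ 2))) * h3⟩
  have hmku : Ideal.Quotient.mk K (a (U 0)) = Ideal.Quotient.mk K (U 0) :=
    (Ideal.Quotient.eq.mpr hKu)
  have hmky : Ideal.Quotient.mk K (a (U 3)) = Ideal.Quotient.mk K (U 3) :=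
    (Ideal.Quotient.eq.mpr hKy)
  have key : I = K := by
    apply le_antisymm
    · refine sup_le ?_ ?_
      · rw [Ideal.span_le]
        rintro x hx
        simp only [Set.mem_insert_iff, Set.mem_singleton_iff] at hx
        rcases hx with rfl | rfl
        · exact hmem _ ⟨U 0 * U 3, by rw [eXa]; ring⟩
        · exact hmem _ ⟨U 3, by rw [eXb]; ring⟩
      · rw [Ideal.span_le]
        rintro _ ⟨⟨l, hl⟩, rfl⟩
        change a (U l) - U l ∈ K
        fin_cases l
        · show a (U 0) - U 0 ∈ K
          exact hKu
        · exact absurd rfl hl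
        · show a (U 2) - U 2 ∈ K
          apply sub_mem_of_mk_eq
          rw [e3, map_mul, map_mul (Ideal.Quotient.mk K), hmku, hmky, map_mul]
        · show a (U 3) - U 3 ∈ K
          exact hKy
        · show a (U 4) - U 4 ∈ K
          apply sub_mem_of_mk_eq
          rw [e4, map_mul, map_pow, map_mul (Ideal.Quotient.mk K), map_pow (Ideal.Quotient.mk K),
            hmku, hmky, map_mul, map_pow]
    · rw [Ideal.span_singleton_le_iff_mem]
      have h : a (U 0) - U 0 ∈ I :=
        Ideal.mem_sup_right (Ideal.subset_span ⟨⟨0, by decide⟩, rfl⟩)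
      have h' : (-(m' * (1 + m * U 0))) * (a (U 0) - U 0) ∈ I := Ideal.mul_mem_left _ _ h
      have eq : (-(m' * (1 + m * U 0))) * (a (U 0) - U 0) = U 0 ^ 2 := by
        rw [hau']
        linear_combination (-(m' * U 0)) * hee' + (U 0 ^ 2) * hmm'
      rw [eq] at h'
      exact h'
  rw [key]
  exact ⟨⟨U 0 ^ 2, rfl⟩⟩

/-- **Chart 3 (`m_j = x_a x_b⁴`, chart B2b): the ideal is `(w²z)`, `w = U₄`, `z = U₁` — TERMINAL
in characteristic 3.** `x_b = w²z`, `x_a = w³z²`, `U₀ = wz²`, `U₂ = wz`; if `x_b` is a unit the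
ideal is `⊤`; otherwise `1 + m z w` is a unit, `a w = w (1 + mzw)²`, `a z (1 + mzw)³ = z` and
`(1 + mzw)³ = 1 + m³z³w³`. [folklore] -/
theorem chart3_isPrincipal [IsLocalRing S] (h3 : (3 : S) = 0)
    (haXa : a Xa = Xa) (haXb : a Xb = Xb + m * Xa)
    (hT : T ∈ nonZeroDivisors S) (hT3 : T = Xa * Xb ^ 4)
    (hU0 : T * U 0 = Xa ^ 4) (hU1 : T * U 1 = Xa ^ 3 * Xb) (hU2 : T * U 2 = Xa ^ 2 * Xb ^ 3)
    (hU3 : T * U 3 = Xa * Xb ^ 4) (hU4 : T * U 4 = Xb ^ 6) :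
    (Ideal.span {Xa, Xb} ⊔
      Ideal.span (Set.range fun l : {l : Fin 5 // l ≠ 3} => a (U l) - U l)).IsPrincipal := by
  subst hT3
  have hXa : Xa ∈ nonZeroDivisors S := nzd_of_mul_left hT
  have hXb : Xb ∈ nonZeroDivisors S := nzd_of_pow_succ (n := 3) (nzd_of_mul_right hT)
  set I := Ideal.span {Xa, Xb} ⊔
    Ideal.span (Set.range fun l : {l : Fin 5 // l ≠ 3} => a (U l) - U l) with hI
  have hXbI : Xb ∈ I :=
    Ideal.mem_sup_left (Ideal.subset_span (Set.mem_insert_of_mem _ (Set.mem_singleton _)))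
  by_cases hXbu : IsUnit Xb
  · exact isPrincipal_of_isUnit_mem hXbI hXbu
  -- `w = U 4`, `z = U 1`: `Xa w = Xb²`, `Xb³ z = Xa²`
  have e1 : Xa * U 4 = Xb ^ 2 := by
    refine cancel_nzd (pow_mem hXb 4) ?_
    linear_combination hU4
  have e2 : Xb ^ 3 * U 1 = Xa ^ 2 := by
    refine cancel_nzd (mul_mem hXa hXb) ?_
    linear_combination hU1
  -- `Xb = z w²`, `Xa = z² w³`
  have eXb : Xb = U 1 * U 4 ^ 2 := by
    refine cancel_nzd (pow_mem hXb 3) ?_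
    linear_combination (-(U 4 ^ 2)) * e2 - (Xa * U 4 + Xb ^ 2) * e1
  have hw0 : U 4 ∈ nonZeroDivisors S := by
    have h : U 1 * U 4 ^ 2 ∈ nonZeroDivisors S := eXb ▸ hXb
    exact nzd_of_pow_succ (n := 1) (nzd_of_mul_right h)
  have eXa : Xa = U 1 ^ 2 * U 4 ^ 3 := by
    refine cancel_nzd hw0 ?_
    linear_combination e1 + (U 1 * U 4 ^ 2 + Xb) * eXb
  -- the other generators
  have e3 : U 0 = U 1 ^ 2 * U 4 := by
    refine cancel_nzd hT ?_
    rw [hU0, eXa, eXb]; ring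
  have e4 : U 2 = U 1 * U 4 := by
    refine cancel_nzd hT ?_
    rw [hU2, eXa, eXb]; ring
  have e5 : a (U 3) - U 3 = 0 := sub_self_of_mul_eq hT (by rw [hU3]) a
  -- the unit `1 + m z w` (`Xb ∈ 𝔪` since it is not a unit, hence `z w ∈ 𝔪`)
  have hεu : IsUnit (1 + m * U 1 * U 4) := by
    have hXbm : Xb ∈ IsLocalRing.maximalIdeal S := (IsLocalRing.mem_maximalIdeal _).mpr hXbu
    have hzw : U 1 * U 4 ∈ IsLocalRing.maximalIdeal S := by
      have hmem : (U 1 * U 4) * U 4 ∈ IsLocalRing.maximalIdeal S := by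
        have : (U 1 * U 4) * U 4 = Xb := by rw [eXb]; ring
        rw [this]; exact hXbm
      rcases (IsLocalRing.maximalIdeal.isMaximal S).isPrime.mem_or_mem hmem with h | h
      · exact h
      · exact Ideal.mul_mem_left _ _ h
    by_contra hne
    have hεm : 1 + m * U 1 * U 4 ∈ IsLocalRing.maximalIdeal S :=
      (IsLocalRing.mem_maximalIdeal _).mpr hne
    have h1 : (1 : S) ∈ IsLocalRing.maximalIdeal S := by
      have : (1 : S) = (1 + m * U 1 * U 4) - m * (U 1 * U 4) := by ring
      rw [this]
      exact Ideal.sub_mem _ hεm (Ideal.mul_mem_left _ _ hzw)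
    exact (IsLocalRing.maximalIdeal.isMaximal S).ne_top
      (Ideal.eq_top_of_isUnit_mem _ h1 isUnit_one)
  obtain ⟨ε', hεε'⟩ := hεu.exists_right_inv
  -- the action
  have haXb' : a Xb = Xb * (1 + m * U 1 * U 4) := by rw [haXb, eXa, eXb]; ring
  have haT : a (Xa * Xb ^ 4) = Xa * Xb ^ 4 * (1 + m * U 1 * U 4) ^ 4 := by
    rw [map_mul, map_pow, haXa, haXb']; ring
  have haw : a (U 4) = U 4 * (1 + m * U 1 * U 4) ^ 2 := by
    have h := congrArg a hU4
    rw [map_mul, haT, map_pow, haXb'] at h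
    have h' : (Xa * Xb ^ 4) * ((1 + m * U 1 * U 4) ^ 4 * a (U 4)) =
        (Xa * Xb ^ 4) * ((1 + m * U 1 * U 4) ^ 4 * (U 4 * (1 + m * U 1 * U 4) ^ 2)) := by
      linear_combination h - (1 + m * U 1 * U 4) ^ 6 * hU4
    have h'' := cancel_nzd hT h'
    calc a (U 4) = ((1 + m * U 1 * U 4) * ε') ^ 4 * a (U 4) := by rw [hεε', one_pow, one_mul]
      _ = ε' ^ 4 * ((1 + m * U 1 * U 4) ^ 4 * a (U 4)) := by ring
      _ = ε' ^ 4 * ((1 + m * U 1 * U 4) ^ 4 * (U 4 * (1 + m * U 1 * U 4) ^ 2)) := by rw [h'']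
      _ = ((1 + m * U 1 * U 4) * ε') ^ 4 * (U 4 * (1 + m * U 1 * U 4) ^ 2) := by ring
      _ = U 4 * (1 + m * U 1 * U 4) ^ 2 := by rw [hεε', one_pow, one_mul]
  have haz : a (U 1) = ε' ^ 3 * U 1 := by
    have h := congrArg a hU1
    rw [map_mul, haT, map_mul, map_pow, haXa, haXb'] at h
    have h' : (Xa * Xb ^ 4) * ((1 + m * U 1 * U 4) * (a (U 1) * (1 + m * U 1 * U 4) ^ 3)) =
        (Xa * Xb ^ 4) * ((1 + m * U 1 * U 4) * U 1) := by
      linear_combination h - (1 + m * U 1 * U 4) * hU1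
    have h'' := cancel_nzd hT h'
    calc a (U 1) = a (U 1) * ((1 + m * U 1 * U 4) * ε') ^ 4 := by rw [hεε', one_pow, mul_one]
      _ = ε' ^ 4 * ((1 + m * U 1 * U 4) * (a (U 1) * (1 + m * U 1 * U 4) ^ 3)) := by ring
      _ = ε' ^ 4 * ((1 + m * U 1 * U 4) * U 1) := by rw [h'']
      _ = ε' ^ 3 * U 1 * ((1 + m * U 1 * U 4) * ε') := by ring
      _ = ε' ^ 3 * U 1 := by rw [hεε', mul_one]
  -- the ideal is `(w² z)`
  let K : Ideal S := Ideal.span {U 4 ^ 2 * U 1}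
  have hmem : ∀ x : S, (∃ q, q * (U 4 ^ 2 * U 1) = x) → x ∈ K := fun x hx =>
    Ideal.mem_span_singleton'.mpr hx
  have hKw : a (U 4) - U 4 ∈ K :=
    hmem _ ⟨2 * m + m ^ 2 * U 1 * U 4, by rw [haw]; ring⟩
  have hKz : a (U 1) - U 1 ∈ K := by
    refine hmem _ ⟨-(m ^ 3 * U 1 ^ 3 * U 4 * ε' ^ 3), ?_⟩
    rw [haz]
    linear_combination (-(U 1 * (1 + (1 + m * U 1 * U 4) * ε' +
        (1 + m * U 1 * U 4) ^ 2 * ε' ^ 2))) * hεε' +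
      (U 1 * ε' ^ 3 * (m * U 1 * U 4 + m ^ 2 * U 1 ^ 2 * U 4 ^ 2)) * h3
  have hmkw : Ideal.Quotient.mk K (a (U 4)) = Ideal.Quotient.mk K (U 4) :=
    Ideal.Quotient.eq.mpr hKw
  have hmkz : Ideal.Quotient.mk K (a (U 1)) = Ideal.Quotient.mk K (U 1) :=
    Ideal.Quotient.eq.mpr hKz
  have key : I = K := by
    apply le_antisymm
    · refine sup_le ?_ ?_
      · rw [Ideal.span_le]
        rintro x hx
        simp only [Set.mem_insert_iff, Set.mem_singleton_iff] at hx
        rcases hx with rfl | rfl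
        · exact hmem _ ⟨U 1 * U 4, by rw [eXa]; ring⟩
        · exact hmem _ ⟨1, by rw [eXb]; ring⟩
      · rw [Ideal.span_le]
        rintro _ ⟨⟨l, hl⟩, rfl⟩
        change a (U l) - U l ∈ K
        fin_cases l
        · show a (U 0) - U 0 ∈ K
          apply sub_mem_of_mk_eq
          rw [e3, map_mul, map_pow, map_mul (Ideal.Quotient.mk K), map_pow (Ideal.Quotient.mk K),
            hmkz, hmkw, map_mul, map_pow]
        · show a (U 1) - U 1 ∈ K
          exact hKz
        · show a (U 2) - U 2 ∈ K
          apply sub_mem_of_mk_eq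
          rw [e4, map_mul, map_mul (Ideal.Quotient.mk K), hmkz, hmkw, map_mul]
        · exact absurd rfl hl
        · show a (U 4) - U 4 ∈ K
          exact hKw
    · rw [Ideal.span_singleton_le_iff_mem]
      have : U 4 ^ 2 * U 1 = Xb := by rw [eXb]; ring
      rw [this]
      exact hXbI
  rw [key]
  exact ⟨⟨U 4 ^ 2 * U 1, rfl⟩⟩


/-- **All five charts at once** (the form consumed by the scheme-level divisorial clause): for
every chart index `j : Fin 5` of `Bl_{K₃}`, with `T = m_j(Xa, Xb)` a non-zero-divisor and
`T · U l = m_l(Xa, Xb)` for all `l`, the ideal `(Xa, Xb) + (a (U l) - U l : l ≠ j)` is principal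
(`S` local of characteristic `3`, `a Xa = Xa`, `a Xb = Xb + m Xa`, `m` a unit). [folklore] -/
theorem chart_isPrincipal [IsLocalRing S] (h3 : (3 : S) = 0) (hm : IsUnit m)
    (haXa : a Xa = Xa) (haXb : a Xb = Xb + m * Xa) (hT : T ∈ nonZeroDivisors S) (j : Fin 5)
    (hTj : T = ![Xa ^ 4, Xa ^ 3 * Xb, Xa ^ 2 * Xb ^ 3, Xa * Xb ^ 4, Xb ^ 6] j)
    (hU0 : T * U 0 = Xa ^ 4) (hU1 : T * U 1 = Xa ^ 3 * Xb) (hU2 : T * U 2 = Xa ^ 2 * Xb ^ 3)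
    (hU3 : T * U 3 = Xa * Xb ^ 4) (hU4 : T * U 4 = Xb ^ 6) :
    (Ideal.span {Xa, Xb} ⊔
      Ideal.span (Set.range fun l : {l : Fin 5 // l ≠ j} => a (U l) - U l)).IsPrincipal := by
  fin_cases j
  · exact chart0_isPrincipal Xa Xb T m U a hm haXa haXb hT (by simpa using hTj) hU1
  · exact chart1_isPrincipal Xa Xb T m U a h3 hm haXa haXb hT (by simpa using hTj) hU0 hU1 hU2
      hU3 hU4
  · exact chart2_isPrincipal Xa Xb T U a hT (by simpa using hTj) hU1 hU3
  · exact chart3_isPrincipal Xa Xb T m U a h3 haXa haXb hT (by simpa using hTj) hU0 hU1 hU2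
      hU3 hU4
  · exact chart4_isPrincipal Xa Xb T m U a haXa haXb hT (by simpa using hTj) hU0 hU1 hU2 hU3 hU4

end Charts

end Summit.ResolutionOfSingularities.ResolutionOfSingularities.Theorems.WildQuotientResolution.JordanThree.K3

end
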